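import Mathlib
import HarnessLib
import Summits.ValiantsHypothesis.ValiantsHypothesis.Theses.MonotoneRestoration
import Literature.Computability.AlgebraicComplexity.ArithCircuit
import Literature.Computability.AlgebraicComplexity.ArithCircuitProofs
import Literature.Computability.AlgebraicComplexity.MonotoneStructure
import Literature.Computability.AlgebraicComplexity.PermanentIrreducible
import Literature.ModelTheory.FiniteModelTheory.CkEquiv
import Summits.ValiantsHypothesis.ValiantsHypothesis.Theorems.MonotoneRestorationMonotoneRestorationQPCosetCount
import Summits.ValiantsHypothesis.ValiantsHypothesis.Theorems.MonotoneRestorationMonotoneRestorationQPSymmetricLB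
import Summits.ValiantsHypothesis.ValiantsHypothesis.Theorems.MonotoneRestorationMonotoneRestorationQPSupportSymmetrisation
import Summits.ValiantsHypothesis.ValiantsHypothesis.Theorems.MonotoneRestorationMonotoneRestorationQPSparseRegime
import Summits.ValiantsHypothesis.ValiantsHypothesis.Theorems.MonotoneRestorationMonotoneRestorationQPBeta
import Literature.Computability.AlgebraicComplexity.SymmetricArithCircuit
import Literature.Computability.AlgebraicComplexity.DawarWilsenach2025Proofs
import Literature.GroupTheory.PermutationGroups.SmallIndexSubgroups
import Summits.ValiantsHypothesis.ValiantsHypothesis.Theorems.MonotoneRestorationQP.Negative.LoadBearing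
import Summits.ValiantsHypothesis.ValiantsHypothesis.Theorems.MonotoneRestorationMonotoneRestorationQPPermSupportCount

/-! TTRL-lite variant V19383 of stmt-ValiantsHypothesis-15886 -/

namespace Summit.ValiantsHypothesis.ValiantsHypothesis.Theorems

open Summit.ValiantsHypothesis.ValiantsHypothesis.Theses.MonotoneRestoration
open Literature.Computability.AlgebraicComplexity

/-- **No cancellation at `+` gates over `ℝ≥0`** (TTRL-lite variant V19383 of
`stub_symmetricMonotone_choose_le_card`): in a labelled arithmetic circuit over the semiring
`NNReal`, the support of the polynomial computed at any child of an addition gate is contained in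
the support of the polynomial computed at the gate, because a sum of nonnegative coefficients
vanishes only if every summand does (`Finset.sum_eq_zero_iff`). This is exactly where `ℝ≥0`
(vs `ℂ`) enters the `+` case of the monotone-restoration induction. [folklore] -/
theorem stub_symmetricMonotone_choose_le_card_var19383 :
    ∀ (n : ℕ) (G : Type) (C : LabelledArithCircuit NNReal (Fin n × Fin n) Unit G) (g h : G),
      C.label g = CircuitLabel.add → h ∈ C.children g →
        (C.eval h).support ⊆ (C.eval g).support := by
  intro n G C g h hadd hmem m hm
  rw [C.eval_of_label_add hadd]
  rw [MvPolynomial.mem_support_iff] at hm ⊢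
  rw [MvPolynomial.coeff_sum]
  intro hsum
  exact hm ((Finset.sum_eq_zero_iff.mp hsum) h hmem)

end Summit.ValiantsHypothesis.ValiantsHypothesis.Theorems
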